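import Literature.Probability.Percolation.CutClusters
import HarnessLib

/-!
# Sandwich modifications of a configuration: the merge lemma and cut clusters

Topic `Literature/Probability/Percolation`; theorems only. Deterministic lemmas about a pair of
bond configurations `η ⊆ ζ` differing by finitely many edges (a **sandwich modification**
`ζ = η ∪ D` with `E(Λ_N) ⊆ D ⊆ E(Λ_{N'})`, as produced by opening a box of labels of a monotone
finite-range block factor), for the Burton–Keane uniqueness argument of
`UniquenessSandwichTolerant.lean` (Bollobás–Riordan, *Percolation* (2006), Ch. 5, Lemma 2 and
Thm. 4, with the cut clusters of `CutClusters.lean` in place of cut-balls):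

* `exists_percolatesAt_of_finite` — a finite modification creates no infinite cluster: every
  infinite `ζ`-cluster contains a vertex (an endpoint of a new edge, or its base point) whose
  `η`-cluster is infinite;
* `mem_exactlyOneInfCluster_of_sandwich` — the merge lemma (Bollobás–Riordan 2006, proof of
  Lemma 2, p. 106) for sandwich modifications opening a connected set `C` met by both infinite
  clusters;
* `exists_exit_of_percolatesAt` — an infinite `η`-cluster meeting the hub `hubIn ζ B c` leaves `B`
  through an exit attached to the hub and carrying an infinite branch of `η -` hub;
* `mem_cutClusterAt_of_three` — three distinct infinite `η`-clusters meeting the hub, plus the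
  LOCALISATION hypothesis "every endpoint of a new edge joined to one of them lies in the hub",
  make `ζ` a cut cluster (the sandwich version of "opening `B_r(x₀)` gives `T_r(x₀)`",
  Bollobás–Riordan 2006, p. 107).

## References

* B. Bollobás, O. Riordan, *Percolation*, CUP 2006, Ch. 5, Lemma 2 and Thm. 4, pp. 105–109 of the
  held copy. [BollobasRiordan2006]

## Mathlib status

No percolation in Mathlib. Anchors: `SimpleGraph.Walk` induction, `Set.Finite.biUnion`,
`Set.Infinite.nonempty`; tree: `hubIn`, `cutClusterAt`, `mem_hubIn_of_adj`,
`exists_adj_reachable_withinGraph_of_walk`, `exactlyOneInfCluster`, `percolatesVia`,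
`outerBoundary`, `edgesIn`.
-/

noncomputable section

namespace Literature.Probability.Percolation

open SimpleGraph Finset

variable {V : Type*}

/-! ### Finite modifications create no infinite cluster -/

/-- **A finite modification creates no infinite cluster.** If every edge of `ζ` which is not an
edge of `η` has all its endpoints in the finite set `W`, then every vertex `u` with
`|C_ζ(u)| = ∞` is joined in `ζ` to a vertex of `W ∪ {u}` whose `η`-cluster is infinite.
(Otherwise the finitely many finite `η`-clusters of these vertices would contain `C_ζ(u)`: follow
an open path of `ζ` backwards from a far vertex `v` to `u`; its first edge leaving `C_η(v)` is a
new edge, with an endpoint in `W`.) [folklore] -/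
theorem exists_percolatesAt_of_finite {η ζ : BondConfig V} (W : Finset V)
    (hW : ∀ e ∈ ζ, e ∉ η → ∀ a ∈ e, a ∈ W) {u : V} (hu : ζ ∈ percolatesAt u) :
    ∃ w, (w = u ∨ w ∈ W) ∧ η ∈ percolatesAt w ∧ (openGraph ζ).Reachable u w := by
  classical
  by_contra hcon
  push Not at hcon
  -- the finitely many candidate clusters
  set I : Finset V := (insert u W).filter fun w => (openGraph ζ).Reachable u w with hI
  set S : Set V := ⋃ w ∈ I, openCluster η w with hS
  have hSfin : S.Finite := by
    refine Set.Finite.biUnion I.finite_toSet fun w hw => ?_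
    rw [hI, Finset.mem_coe, Finset.mem_filter, Finset.mem_insert] at hw
    exact Set.not_infinite.1 (hcon w hw.1 · hw.2)
  -- a far point of the infinite `ζ`-cluster of `u`
  obtain ⟨v, hv, hvS⟩ := (hu.sdiff hSfin).nonempty
  obtain ⟨p⟩ := (show (openGraph ζ).Reachable u v from hv).symm
  -- `u ∉ C_η(v)` since `v ∉ S ⊇ C_η(u)`
  have huT : u ∉ openCluster η v := by
    intro h
    apply hvS
    refine Set.mem_biUnion (x := u) ?_ ?_
    · rw [hI, Finset.mem_coe, Finset.mem_filter]
      exact ⟨Finset.mem_insert_self _ _, Reachable.refl _⟩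
    · exact (show (openGraph η).Reachable v u from h).symm
  obtain ⟨a, b, ha, hb, hab, -, hr⟩ := exists_adj_reachable_withinGraph_of_walk
    (openGraph ζ) p (S := openCluster η v) (mem_openCluster_self η v) ⟨u, p.end_mem_support, huT⟩
  -- the exit edge is new, so `a ∈ W`
  have hab' : s(a, b) ∈ ζ := by rw [openGraph_adj] at hab; exact hab.1
  have habη : s(a, b) ∉ η := by
    intro h
    apply hb
    exact (show (openGraph η).Reachable v a from ha).trans
      (Adj.reachable (by rw [openGraph_adj]; exact ⟨h, hab.ne⟩))
  have haW : a ∈ W := hW _ hab' habη a (Sym2.mem_mk_left a b)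
  have hua : (openGraph ζ).Reachable u a :=
    (show (openGraph ζ).Reachable u v from hv).trans (hr.mono (withinGraph_le _ _))
  apply hvS
  refine Set.mem_biUnion (x := a) ?_ ?_
  · rw [hI, Finset.mem_coe, Finset.mem_filter]
    exact ⟨Finset.mem_insert_of_mem haW, hua⟩
  · exact (show (openGraph η).Reachable v a from ha).symm

/-- If the edges of `G` inside `C` are open in `ζ` then `C` is connected in the open graph of `ζ`,
as soon as `C` is connected in `G` through edges inside `C`. [folklore] -/
theorem reachable_of_edgesIn_subset [DecidableEq V] {G : SimpleGraph V} [G.LocallyFinite]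
    {C : Finset V} (hC : ∀ x ∈ C, ∀ y ∈ C, (withinGraph G ↑C).Reachable x y)
    {ζ : BondConfig V} (hCζ : (↑(LatticeModels.edgesIn G C) : Set (Sym2 V)) ⊆ ζ) {x y : V} (hx : x ∈ C) (hy : y ∈ C) :
    (withinGraph (openGraph ζ) ↑C).Reachable x y := by
  refine (hC x hx y hy).mono ?_
  rintro a b ⟨hab, ha, hb⟩
  refine ⟨?_, ha, hb⟩
  rw [openGraph_adj]
  refine ⟨hCζ ?_, hab.ne⟩
  rw [Finset.mem_coe, LatticeModels.mem_edgesIn_iff]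
  exact ⟨hab, fun c hc => by rcases Sym2.mem_iff.1 hc with rfl | rfl <;> assumption⟩

/-! ### The merge lemma for sandwich modifications (Bollobás–Riordan 2006, Ch. 5, Lemma 2) -/

/-- **Merge lemma, sandwich form** (Bollobás–Riordan 2006, Ch. 5, proof of Lemma 2, p. 106, for
the modification "open all sites of `B_n(x₀)`"; here the modification `ζ ⊇ η` opens all edges of
`G` inside the connected set `C` and possibly finitely many further edges, all with endpoints in
`W`). If `η` has an infinite cluster at `x ∈ C` and every infinite cluster of `η` is the cluster
of `x` or of `y ∈ C`, then `ζ` has exactly one infinite cluster. [cite: BollobasRiordan2006, Ch. 5, proof of Lemma 2 (p. 106)] -/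
theorem mem_exactlyOneInfCluster_of_sandwich [DecidableEq V] {G : SimpleGraph V} [G.LocallyFinite]
    {C : Finset V} (hC : ∀ x ∈ C, ∀ y ∈ C, (withinGraph G ↑C).Reachable x y) (W : Finset V)
    {η ζ : BondConfig V} (hηζ : η ⊆ ζ) (hCζ : (↑(LatticeModels.edgesIn G C) : Set (Sym2 V)) ⊆ ζ)
    (hW : ∀ e ∈ ζ, e ∉ η → ∀ a ∈ e, a ∈ W) {x y : V} (hx : x ∈ C) (hy : y ∈ C)
    (hpx : η ∈ percolatesAt x)
    (hall : ∀ z, η ∈ percolatesAt z → (openGraph η).Reachable z x ∨ (openGraph η).Reachable z y) :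
    ζ ∈ exactlyOneInfCluster V := by
  have hle : openGraph η ≤ openGraph ζ := fromEdgeSet_mono hηζ
  have hyx : (openGraph ζ).Reachable y x :=
    (reachable_of_edgesIn_subset hC hCζ hy hx).mono (withinGraph_le _ _)
  -- every vertex percolating in `ζ` is joined to `x` in `ζ`
  have key : ∀ u, ζ ∈ percolatesAt u → (openGraph ζ).Reachable u x := by
    intro u hu
    obtain ⟨w, -, hw, huw⟩ := exists_percolatesAt_of_finite W hW hu
    rcases hall w hw with h | h
    · exact huw.trans (h.mono hle)
    · exact (huw.trans (h.mono hle)).trans hyx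
  exact ⟨⟨x, percolatesAt_mono hηζ x hpx⟩, fun u v hu hv => (key u hu).trans (key v hv).symm⟩

/-! ### Exits of an infinite cluster through the hub -/

/-- **Exit lemma.** Let `η ⊆ ζ ⊆ E(G)`-configurations (`G` locally finite, `η ⊆ E(G)`), `B` a
finite set and `K = hubIn ζ B c` the hub of the larger configuration. An infinite `η`-cluster
meeting `K` at `x` leaves `B` through an **exit**: a vertex `a ∉ B` joined to `K` by an open edge
of `η`, joined to `x` in `η`, and lying in an infinite open cluster of `η - K`. (Every vertex of
`C_η(x) ∖ B` is joined in `η - K` to the far endpoint of the first edge into `K` of an open path to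
`x`; that endpoint lies outside `B` — a vertex of `B` attached to the hub by an open edge is in the
hub — so there are finitely many exits, one of which carries an infinite branch. The observation
behind Bollobás–Riordan 2006, Ch. 5, p. 107, for hubs instead of balls.) [cite: BollobasRiordan2006, Ch. 5, proof of Thm. 4 (p. 107)] -/
theorem exists_exit_of_percolatesAt [DecidableEq V] {G : SimpleGraph V} [G.LocallyFinite]
    {B : Finset V} {c : V} {η ζ : BondConfig V} (hηζ : η ⊆ ζ) (hηG : η ⊆ G.edgeSet) {x : V}
    (hx : x ∈ hubIn ζ B c) (hperc : η ∈ percolatesAt x) :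
    ∃ a, a ∉ B ∧ (∃ k ∈ hubIn ζ B c, (openGraph η).Adj k a) ∧ (openGraph η).Reachable x a ∧
      η ∈ percolatesVia (withinGraph ⊤ (↑(hubIn ζ B c) : Set V)ᶜ) a := by
  classical
  set K := hubIn ζ B c with hK
  have hKB : K ⊆ B := hubIn_subset ζ B c
  -- the exits: neighbours of `K` outside `B`, joined to `x`
  set N : Finset V := (LatticeModels.outerBoundary G B).filter fun a =>
    (∃ k ∈ K, (openGraph η).Adj k a) ∧ (openGraph η).Reachable x a with hN
  -- every vertex of `C_η(x) ∖ B` lies in the `(η - K)`-cluster of an exit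
  have hcover : openCluster η x \ ↑B ⊆ ⋃ a ∈ N, openClusterIn (withinGraph ⊤ (↑K : Set V)ᶜ) η a := by
    rintro u ⟨hu, huB⟩
    have huK : u ∈ (↑K : Set V)ᶜ := fun h => huB (hKB h)
    obtain ⟨q⟩ := (show (openGraph η).Reachable x u from hu).symm
    obtain ⟨a, b, ha, hb, hab, -, hr⟩ := exists_adj_reachable_withinGraph_of_walk
      (openGraph η) q (S := (↑K : Set V)ᶜ) huK ⟨x, q.end_mem_support, fun h => h hx⟩
    have hb' : b ∈ K := by simpa using hb
    have hGab : G.Adj a b := hηG (by rw [openGraph_adj] at hab; exact hab.1)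
    -- `a ∉ B`: a vertex of `B` attached to the hub by an open edge is in the hub
    have haB : a ∉ B := fun haB =>
      ha (mem_hubIn_of_adj hb' haB ((fromEdgeSet_mono hηζ) hab.symm))
    have hxa : (openGraph η).Reachable x a := hu.trans (hr.mono (withinGraph_le _ _))
    refine Set.mem_biUnion (x := a) ?_ ?_
    · rw [hN, Finset.mem_coe, Finset.mem_filter, LatticeModels.mem_outerBoundary_iff]
      exact ⟨⟨haB, b, hKB hb', hGab⟩, ⟨b, hb', hab.symm⟩, hxa⟩
    · rw [mem_openClusterIn_withinGraph_top_iff]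
      exact hr.symm
  -- `C_η(x) ∖ B` is infinite, so some exit cluster is infinite
  have hinf : (openCluster η x \ ↑B).Infinite := hperc.sdiff B.finite_toSet
  by_contra hcon
  push Not at hcon
  refine hinf ((Set.Finite.biUnion N.finite_toSet fun a ha => ?_).subset hcover)
  rw [hN, Finset.mem_coe, Finset.mem_filter, LatticeModels.mem_outerBoundary_iff] at ha
  exact Set.not_infinite.1 (hcon a ha.1.1 ha.2.1 ha.2.2)

/-! ### Three clusters and localisation make a cut cluster -/

/-- **Three clusters make a cut cluster** (the sandwich version of "opening `B_r(x₀)` gives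
`T_r(x₀)`", Bollobás–Riordan 2006, Ch. 5, p. 107). Let `η ⊆ ζ`, `η ⊆ E(G)`, all edges of `ζ ∖ η`
having their endpoints in the finite set `Z`; let three vertices `x i` of the hub
`K = hubIn ζ B c` lie in distinct infinite `η`-clusters, and suppose (LOCALISATION) that every
vertex of `Z` joined in `η` to some `x i` belongs to `K`. Then `ζ` is a cut cluster at `c` in `B`:
the three exits of `exists_exit_of_percolatesAt` are separated in `ζ - K`, because an open path of
`ζ` avoiding `K` that starts in the `η`-cluster of `x i` never uses a new edge (its vertices stay
joined to `x i` in `η`, and a vertex of `Z` joined to `x i` would be in `K`). [cite: BollobasRiordan2006, Ch. 5, proof of Thm. 4 (p. 107)] -/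
theorem mem_cutClusterAt_of_three [DecidableEq V] {G : SimpleGraph V} [G.LocallyFinite]
    {B Z : Finset V} {c : V} {η ζ : BondConfig V} (hηζ : η ⊆ ζ) (hηG : η ⊆ G.edgeSet)
    (hnew : ∀ e ∈ ζ, e ∉ η → ∀ a ∈ e, a ∈ Z) {x : Fin 3 → V} (hxK : ∀ i, x i ∈ hubIn ζ B c)
    (hperc : ∀ i, η ∈ percolatesAt (x i)) (hdis : ∀ i j, (openGraph η).Reachable (x i) (x j) → i = j)
    (hloc : ∀ p ∈ Z, ∀ i, (openGraph η).Reachable (x i) p → p ∈ hubIn ζ B c) :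
    ζ ∈ cutClusterAt B c := by
  classical
  set K := hubIn ζ B c with hK
  choose a haB hKa hxa hperca using fun i => exists_exit_of_percolatesAt hηζ hηG (hxK i) (hperc i)
  -- an open path of `ζ` avoiding `K`, started in `C_η(x i)`, stays in `C_η(x i)`
  have stay : ∀ (i : Fin 3) (u v : V) (π : (withinGraph (openGraph ζ) (↑K : Set V)ᶜ).Walk u v),
      (openGraph η).Reachable (x i) u → (openGraph η).Reachable (x i) v := by
    intro i u v π
    induction π with
    | nil => exact id
    | @cons u u' v h π' ih =>
      intro hu
      refine ih ?_
      obtain ⟨hadj, huK, -⟩ := h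
      rw [openGraph_adj] at hadj
      by_cases hη : s(u, u') ∈ η
      · exact hu.trans (Adj.reachable (by rw [openGraph_adj]; exact ⟨hη, hadj.2⟩))
      · exact absurd (hloc u (hnew _ hadj.1 hη u (Sym2.mem_mk_left u u')) i hu) huK
  refine ⟨a, fun i h => haB i (hubIn_subset ζ B c h), fun i => ?_, fun i j hij => ?_, fun i => ?_⟩
  · obtain ⟨k, hk, hadj⟩ := hKa i
    exact ⟨k, hk, (fromEdgeSet_mono hηζ) hadj⟩
  · change a j ∈ openClusterIn _ _ (a i) at hij
    rw [mem_openClusterIn_withinGraph_top_iff] at hij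
    obtain ⟨π⟩ := hij
    exact hdis i j ((stay i _ _ π (hxa i)).trans (hxa j).symm)
  · exact isUpperSet_percolatesVia _ _ hηζ (hperca i)

end Literature.Probability.Percolation

end
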